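import Summits.BirchSwinnertonDyer.BirchSwinnertonDyer.Theses.ByReductionTypeAtTwo
import Summits.BirchSwinnertonDyer.BirchSwinnertonDyer.Theorems.ByReductionTypeAtTwoRankOneAtTwoBigImageOddLocalOneDoorFull
import Summits.BirchSwinnertonDyer.Rank1Residual.Partition.MainConjecturesAnticyclotomicGood
import HarnessLib

/-!
# Sketch — crux-ideate on `RankOneAtTwoOffBigImageOddLocal` (item stmt-BirchSwinnertonDyer-23716), ideator 1, round 1

First-lemma signatures for the idea cards `off-slice-door-bits` (card A) and `go-borel-gl1-transport-at-two`
(card B), typed over existing tree declarations.  Nothing here proves BSD or the crux; the only proved statements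
are the structural split `offBigImage_of_halves` (the crux follows from its `E(ℚ)[2] = 0` half and its
`E(ℚ)[2] ≠ 0` half) and the instantiation at `p = 2` of the tree's p-generic anticyclotomic composition
`two_mul_index_eq_of_onTreeGoodLinks`.
-/

noncomputable section

open scoped Classical

namespace Summit.BirchSwinnertonDyer.BirchSwinnertonDyer.Cruxes.RankOneAtTwoOffBigImageOddLocal.Sketch

open WeierstrassCurve NumberField IsDedekindDomain Literature.NumberTheory.EllipticCurves
  Literature.NumberTheory.EllipticCurves.ModularForms
  Literature.NumberTheory.EllipticCurves.Rank1Residual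
  Summit.BirchSwinnertonDyer.Rank1Residual.F1Sign2
  Summit.BirchSwinnertonDyer.BirchSwinnertonDyer.Theorems.RankOneAtTwoOneDoor
  Summit.BirchSwinnertonDyer.Rank1Residual.X11b
  Summit.BirchSwinnertonDyer.Rank1Residual.X11b.AcSelmer

/-- The slice predicate of the sibling crux 23715 (big 2-adic image, odd torsion, odd Tamagawa product). -/
def OnSlice (W : WeierstrassCurve ℚ) [W.IsElliptic] [W.IsGloballyMinimal] : Prop :=
  (∀ n : ℕ, W.HasSurjectiveModNGaloisRep ((2 ^ n : ℕ) : ℤ)) ∧ Odd W.torsionOrder ∧ Odd W.tamagawaProduct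

/-! ## The natural first split of the crux: `E(ℚ)[2] = 0` (strata γ₁ γ₂ δ) versus `E(ℚ)[2] ≠ 0` (bulk β) -/

/-- Card A's half: off-slice curves WITHOUT rational 2-torsion (C3 image, S3-but-not-2-adically-surjective image,
or surjective image with even Tamagawa product). -/
def NoTwoTorsionHalf : Prop :=
  ∀ (W : WeierstrassCurve ℚ) [W.IsElliptic] [W.IsGloballyMinimal], ¬ W.HasCM → NoRationalTwoTorsion W →
    ¬ OnSlice W → W.analyticRank = 1 → BSDp W 2

/-- Card B's half: curves WITH a rational 2-torsion point (automatically off-slice). -/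
def TwoTorsionHalf : Prop :=
  ∀ (W : WeierstrassCurve ℚ) [W.IsElliptic] [W.IsGloballyMinimal], ¬ W.HasCM → ¬ NoRationalTwoTorsion W →
    W.analyticRank = 1 → BSDp W 2

/-- **Structural split (proved):** the crux is the conjunction of its two halves. -/
theorem offBigImage_of_halves (hA : NoTwoTorsionHalf) (hB : TwoTorsionHalf) :
    Summit.BirchSwinnertonDyer.BirchSwinnertonDyer.Theses.ByReductionTypeAtTwo.RankOneAtTwoOffBigImageOddLocal := by
  intro W _ _ hcm hoff hr
  by_cases h2 : NoRationalTwoTorsion W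
  · exact hA W hcm h2 hoff hr
  · exact hB W hcm h2 hr

/-! ## Card A — `off-slice-door-bits`: the one-door law with the local bits made explicit -/

/-- **C⁺_A `OffSliceDoorIndexLawAtTwo`** — `DoorIndexLawFullAtTwo` with the slice binders
(`ρ_{W,2^∞}` onto, `T` odd, `∏ c_ℓ` odd) REPLACED by `E(ℚ)[2] = 0 ∧ ¬ slice`, and the right-hand side carrying the
Tamagawa valuation `2·v₂ ∏_ℓ c_ℓ(W)` (Gross's Conjecture-1.2 shape at `p = 2`; census law P27.1, cornerTE 159/159). -/
def OffSliceDoorIndexLawAtTwo : Prop :=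
  ∀ (W : WeierstrassCurve ℚ) [W.IsElliptic] [W.IsGloballyMinimal] [NeZero (W.conductorNorm ℤ)],
    ¬ W.HasCM → NoRationalTwoTorsion W → ¬ OnSlice W → W.analyticRank = 1 →
    ∀ (K : Type) [Field K] [NumberField K], IsImaginaryQuadratic K →
      DoorAdmissible W (NumberField.discr K) →
      (W.quadraticTwist (NumberField.discr K : ℚ)).entireLFunction 1 ≠ 0 →
      ∀ (Dt : ModularParametrizationData W (W.conductorNorm ℤ))
        (H : HeegnerDatum (W.conductorNorm ℤ) (NumberField.discr K)) (ι : K →+* ℂ)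
        (P : (W.baseChange K).toAffine.Point),
        WeierstrassCurve.Affine.Point.map ι.toRatAlgHom P = heegnerPointComplex Dt H → ¬ (2 : ℤ) ∣ Dt.c →
        ∀ (Wd : WeierstrassCurve ℚ) [Wd.IsElliptic] [Wd.IsGloballyMinimal] (Cd : WeierstrassCurve.VariableChange ℚ),
          Cd • W.quadraticTwist (NumberField.discr K : ℚ) = Wd →
          ∃ m : ℕ, HasTwoDivisibilityUpToTorsion W K P m ∧
            2 * m + (if W.Δ < 0 then 1 else 0) =
              padicValNat 2 (Nat.card (AddCommGroup.primaryComponent W.sha 2)) +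
                padicValNat 2 (Nat.card (AddCommGroup.primaryComponent Wd.sha 2)) +
                transpCount W (NumberField.discr K) + 2 * identCount W (NumberField.discr K) +
                2 * padicValNat 2 W.tamagawaProduct

/-- **First lemma of card A (kernel side, M-sized): the per-datum iff WITHOUT the odd-Tamagawa binder.**
Shape of the lead's `bsdp_two_iff_doorLawFull_at` (p615533) with `hT`/`hc` replaced by `NoRationalTwoTorsion W` and the
Tamagawa valuation moved to the right-hand side.  Stated as a `Prop` (to be proved in a line, not here). -/
def OffSliceKernelIffAtTwo : Prop :=
  rank_eq_analyticRank_of_analyticRank_le_one → hasEntireLFunction_rat → DoorTwistTamagawaAtTwo →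
  ∀ (W : WeierstrassCurve ℚ) [W.IsElliptic] [W.IsGloballyMinimal] [NeZero (W.conductorNorm ℤ)],
    NoRationalTwoTorsion W → W.analyticRank = 1 →
    ∀ (K : Type) [Field K] [NumberField K], IsImaginaryQuadratic K →
      gross_zagier (W.conductorNorm ℤ) W K → kolyvagin (W.conductorNorm ℤ) W K →
      DoorAdmissible W (NumberField.discr K) → SatisfiesHeegnerHypothesis (W.conductorNorm ℤ) K →
      (W.quadraticTwist (NumberField.discr K : ℚ)).entireLFunction 1 ≠ 0 →
      ∀ (Dt : ModularParametrizationData W (W.conductorNorm ℤ)), ¬ (2 : ℤ) ∣ Dt.c →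
      ∀ (H : HeegnerDatum (W.conductorNorm ℤ) (NumberField.discr K)) (ι : K →+* ℂ)
        (P : (W.baseChange K).toAffine.Point),
        WeierstrassCurve.Affine.Point.map ι.toRatAlgHom P = heegnerPointComplex Dt H →
        ∀ (Wd : WeierstrassCurve ℚ) [Wd.IsElliptic] [Wd.IsGloballyMinimal] (Cd : VariableChange ℚ),
          Cd • W.quadraticTwist (NumberField.discr K : ℚ) = Wd → BSDp Wd 2 →
          (BSDp W 2 ↔
            ∃ m : ℕ, HasTwoDivisibilityUpToTorsion W K P m ∧
              2 * m + (if W.Δ < 0 then 1 else 0) =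
                padicValNat 2 (Nat.card (AddCommGroup.primaryComponent W.sha 2)) +
                  padicValNat 2 (Nat.card (AddCommGroup.primaryComponent Wd.sha 2)) +
                  transpCount W (NumberField.discr K) + 2 * identCount W (NumberField.discr K) +
                  2 * padicValNat 2 W.tamagawaProduct)

/-! ## Card B — `go-borel-gl1-transport-at-two`: the anticyclotomic links AT `p = 2` on the Borel (2-torsion) locus -/

/-- **C⁺_B `EisensteinAnticyclotomicLinksAtTwo`** — for a non-CM rank-one curve with a RATIONAL 2-TORSION POINT and good
ordinary reduction at `2`, at every imaginary quadratic Heegner field `K` with `2` split and every anticyclotomic datum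
`(κ, γ, 𝔭, ι)` at `2`, the two tree-typed links hold AT `p = 2`: the anticyclotomic IMC equality at the trivial character
composed with the `2`-adic Waldspurger/BDP value (`IMCWaldspurgerOnTreeGoodAt 2 …`) and anticyclotomic control at `2`
(`ControlOnTreeGoodAt 2 …`).  The bet of the card: on the Borel locus both are reachable by Greenberg–Vatsal transport along
the rational 2-isogeny onto GL₁ Iwasawa modules over abelian extensions of `K`, whose main conjecture at `p = 2` is in print. -/
def EisensteinAnticyclotomicLinksAtTwo : Prop :=
  ∀ (W : WeierstrassCurve ℚ) [W.IsElliptic] [W.IsGloballyMinimal] [NeZero (W.conductorNorm ℤ)], ¬ W.HasCM → ¬ NoRationalTwoTorsion W →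
    GoodOrd W 2 → W.analyticRank = 1 →
    ∀ (K : Type) [Field K] [NumberField K], IsImaginaryQuadratic K →
      SatisfiesHeegnerHypothesis (W.conductorNorm ℤ) K → SatisfiesHeegnerHypothesis 2 K →
      ∀ (Dt : ModularParametrizationData W (W.conductorNorm ℤ))
        (H : HeegnerDatum (W.conductorNorm ℤ) (NumberField.discr K)) (ιc : K →+* ℂ)
        (P : (W.baseChange K).toAffine.Point),
        WeierstrassCurve.Affine.Point.map ιc.toRatAlgHom P = heegnerPointComplex Dt H →
        ∀ (κ : ZpExtension K 2) (γ : Field.absoluteGaloisGroup K) [Fact (κ.IsTopGenerator γ)]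
          (𝔭 : HeightOneSpectrum (𝓞 K)) (ι : K →+* ℚ_[2]),
          κ.IsAnticyclotomic → ((2 : ℕ) : 𝓞 K) ∈ 𝔭.asIdeal → 𝔭.asIdeal.inertiaDeg (𝓞 ℚ) = 1 →
          IMCWaldspurgerOnTreeGoodAt 2 κ 𝔭 γ ι P ∧ ControlOnTreeGoodAt 2 κ 𝔭 γ ι P

/-- **First lemma of card B (proved, p-generic tree composition instantiated at `p = 2`):** the two links at `2` give the
`Λ`-adic Heegner-index identity over `K` at `2`:
`v₂ #Ш(E/K)[2^∞] + v₂ ∏_{w∣N⁺} c_w(E/K) = 2·v₂ [E(K) : ℤP]` — the anomalous factor `(#Ẽ(𝔽₂)/2)²` has already cancelled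
between the control term and the `2`-adic Waldspurger term inside the socket definitions. -/
theorem indexIdentity_at_two_of_links {W : WeierstrassCurve ℚ} [W.IsElliptic] [W.IsGloballyMinimal]
    {K : Type} [Field K] [NumberField K] (κ : ZpExtension K 2) (𝔭 : HeightOneSpectrum (𝓞 K))
    (γ : Field.absoluteGaloisGroup K) [Fact (κ.IsTopGenerator γ)] (ι : K →+* ℚ_[2])
    {P : (W.baseChange K).toAffine.Point}
    (hIW : IMCWaldspurgerOnTreeGoodAt 2 κ 𝔭 γ ι P) (hCTL : ControlOnTreeGoodAt 2 κ 𝔭 γ ι P) :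
    (padicValNat 2 (Nat.card (AddCommGroup.primaryComponent (W.baseChange K).sha 2)) : ℤ) +
        padicValNat 2 (tamagawaProductSplit W K) =
      2 * (padicValNat 2 (AddSubgroup.zmultiples P).index : ℤ) :=
  two_mul_index_eq_of_onTreeGoodLinks hIW hCTL

/-- **The GL₁ transport target of card B, as a shape (definition request flagged on the card):** on the Borel locus the
`Λ_ac`-characteristic power of the tree's `X_ac(E/K_∞)` at `2` should equal, up to the explicitly transported finite
error, the product of two GL₁ anticyclotomic Iwasawa invariants of `K` cut out by the characters `E[φ] ≅ ℤ/2` and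
`E'[φ̂] ≅ μ₂` (both TRIVIAL mod 2).  We only record here the valuation-level consequence the line needs: SOME `n` with
`XAc.HasCharValuationAt … 2 … n` (torsion-ness + a computable valuation at `𝟙`), which is the common first conjunct of both links. -/
def AcTorsionAtTwoOnBorelLocus : Prop :=
  ∀ (W : WeierstrassCurve ℚ) [W.IsElliptic] [W.IsGloballyMinimal], ¬ W.HasCM → ¬ NoRationalTwoTorsion W →
    GoodOrd W 2 → W.analyticRank = 1 →
    ∀ (K : Type) [Field K] [NumberField K], IsImaginaryQuadratic K →
      SatisfiesHeegnerHypothesis (W.conductorNorm ℤ) K → SatisfiesHeegnerHypothesis 2 K →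
      ∀ (κ : ZpExtension K 2) (γ : Field.absoluteGaloisGroup K) [Fact (κ.IsTopGenerator γ)]
        (𝔭 : HeightOneSpectrum (𝓞 K)), κ.IsAnticyclotomic → ((2 : ℕ) : 𝓞 K) ∈ 𝔭.asIdeal →
        ∃ n : ℕ, XAc.HasCharValuationAt (W.baseChange K) 2 κ 𝔭 ∅ γ n

end Summit.BirchSwinnertonDyer.BirchSwinnertonDyer.Cruxes.RankOneAtTwoOffBigImageOddLocal.Sketch

end
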